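import Summits.ResolutionOfSingularities.ResolutionOfSingularities.Theorems.PAlterationPialtKnownCases
import Literature.AlgebraicGeometry.Resolution.AlterationsPurelyInseparable
import HarnessLib

/-!
# `Pialt` (crux stmt-ResolutionOfSingularities-0555): reductions usable by any line

Companion to `PAlterationPialtKnownCases.lean` (landed `--supports stmt-ResolutionOfSingularities-0555`;
does not close the item). Two reductions of the crux `Pialt` (= the positive-characteristic slice
of the open Abramovich–Oort conjecture, Temkin 2013 Conj. 1.3.1), from the Literature API
`IsPurelyInseparableAlteration.comp` / `abramovichOort_of_forall_normal`
(`Literature/AlgebraicGeometry/Resolution/AlterationsPurelyInseparable.lean`):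

* `pialtConclusion_of_isPurelyInseparableAlteration` — the conclusion of `Pialt` DESCENDS along
  every purely inseparable alteration `X' → X` (normalisation, proper birational models, finite
  radicial covers by integral schemes, compositions of these): purely inseparable alterations
  compose (de Jong 1996, 2.20);
* `pialt_iff_forall_normal` — `Pialt` is equivalent to its restriction to NORMAL varieties
  (normalise first). With the known cases, a counterexample to `Pialt`, if any, may be taken to be
  an integral normal variety of dimension `≥ 4`.

Sources: A. J. de Jong, Publ. Math. IHÉS 83 (1996), 2.20; M. Temkin, J. Algebra 373 (2013), §1.3.
-/

noncomputable section

set_option linter.dupNamespace false -- mandated namespace of this single-conjunct summit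

namespace Summit.ResolutionOfSingularities.ResolutionOfSingularities.Theorems

open CategoryTheory AlgebraicGeometry TopologicalSpace
open Literature.AlgebraicGeometry.Resolution
open Summit.ResolutionOfSingularities.ResolutionOfSingularities.Theses.PAlteration (Pialt)

/-- **`Pialt` transfers down a purely inseparable alteration**: if `φ : X' → X` is a purely
inseparable alteration of the integral scheme `X` (e.g. its normalisation, a proper birational
model, a finite radicial cover by an integral scheme) and the conclusion of `Pialt` holds for `X'`,
then it holds for `X` — purely inseparable alterations compose
(`IsPurelyInseparableAlteration.comp`, de Jong 1996, 2.20). [cite: DeJong1996, 2.20] -/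
theorem pialtConclusion_of_isPurelyInseparableAlteration {X' X : Scheme.{0}} [IsIntegral X]
    {φ : X' ⟶ X} (hφ : IsPurelyInseparableAlteration φ)
    (h : ∃ (X'' : Scheme.{0}) (g : X'' ⟶ X'), IsProper g ∧ IsIntegral X'' ∧ Scheme.IsRegular X'' ∧
      Function.Surjective g.base ∧ ∃ U : X'.Opens, Dense (U : Set X') ∧ IsFinite (g ∣_ U) ∧
        UniversallyInjective (g ∣_ U)) :
    ∃ (X'' : Scheme.{0}) (g : X'' ⟶ X), IsProper g ∧ IsIntegral X'' ∧ Scheme.IsRegular X'' ∧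
      Function.Surjective g.base ∧ ∃ U : X.Opens, Dense (U : Set X) ∧ IsFinite (g ∣_ U) ∧
        UniversallyInjective (g ∣_ U) := by
  haveI := hφ.isIntegral
  exact pialtConclusion_of_exists_isPurelyInseparableAlteration
    (exists_isPurelyInseparableAlteration_of_isPurelyInseparableAlteration hφ
      (exists_isPurelyInseparableAlteration_of_pialtConclusion h))

/-- **Reduction of `Pialt` to normal varieties**: `Pialt` is equivalent to its restriction to
integral NORMAL (all local rings integrally closed) separated schemes of finite type — normalise
first: `X^ν → X` is a finite birational, hence purely inseparable, alteration over the same field,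
and purely inseparable alterations compose (`abramovichOort_of_forall_normal`). So a counterexample
to `Pialt`, if any, may be taken normal. [folklore] -/
theorem pialt_iff_forall_normal :
    Pialt ↔ ∀ p : ℕ, p.Prime → ∀ (k : Type) [Field k] [CharP k p] (X : Scheme.{0})
      (f : X ⟶ Spec (.of k)), IsSeparated f → LocallyOfFiniteType f → QuasiCompact f →
        IsIntegral X → (∀ x : X, IsIntegrallyClosed (X.presheaf.stalk x)) →
          ∃ (X' : Scheme.{0}) (g : X' ⟶ X), IsProper g ∧ IsIntegral X' ∧ Scheme.IsRegular X' ∧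
            Function.Surjective g.base ∧ ∃ U : X.Opens, Dense (U : Set X) ∧ IsFinite (g ∣_ U) ∧
              UniversallyInjective (g ∣_ U) := by
  refine ⟨fun h p hp k _ _ X f hs hl hq hi _ => ?_, fun h => ?_⟩
  · unfold Pialt at h
    exact h p hp k X f hs hl hq hi
  · rw [pialt_iff_forall_isPurelyInseparableAlteration]
    intro p hp k _ _ X f hs hl hq hi
    haveI := hs; haveI := hl; haveI := hq; haveI := hi
    refine abramovichOort_of_forall_normal k (fun Y g hs' hl' hq' hi' hn => ?_) X f
    haveI := hi'
    exact exists_isPurelyInseparableAlteration_of_pialtConclusion (h p hp k Y g hs' hl' hq' hi' hn)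

/-- **`Pialt` transfers down a finite radicial cover by an integral scheme** (the shape in which
Frobenius twists and the route's `Picover`-type covers enter): if `g : X' → X` is finite,
universally injective and surjective with `X'` integral (and `X` integral), then the conclusion of
`Pialt` for `X'` gives it for `X` — such a `g` is a purely inseparable alteration with `U = X`.
[cite: DeJong1996, 2.20] -/
theorem pialtConclusion_of_finite_universallyInjective_surjective {X' X : Scheme.{0}} [IsIntegral X]
    [IsIntegral X'] (g : X' ⟶ X) [IsFinite g] [UniversallyInjective g] [Surjective g]
    (h : ∃ (X'' : Scheme.{0}) (g' : X'' ⟶ X'), IsProper g' ∧ IsIntegral X'' ∧ Scheme.IsRegular X'' ∧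
      Function.Surjective g'.base ∧ ∃ U : X'.Opens, Dense (U : Set X') ∧ IsFinite (g' ∣_ U) ∧
        UniversallyInjective (g' ∣_ U)) :
    ∃ (X'' : Scheme.{0}) (g' : X'' ⟶ X), IsProper g' ∧ IsIntegral X'' ∧ Scheme.IsRegular X'' ∧
      Function.Surjective g'.base ∧ ∃ U : X.Opens, Dense (U : Set X) ∧ IsFinite (g' ∣_ U) ∧
        UniversallyInjective (g' ∣_ U) := by
  refine pialtConclusion_of_isPurelyInseparableAlteration (φ := g) ⟨inferInstance, inferInstance,
    inferInstance, ⊤, ?_, ?_, ?_⟩ h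
  · simp
  · infer_instance
  · exact IsZariskiLocalAtTarget.restrict ‹UniversallyInjective g› ⊤

end Summit.ResolutionOfSingularities.ResolutionOfSingularities.Theorems

end
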